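import Mathlib
import Literature.Combinatorics.Enumerative.DerivativePolynomialGeneratingFunctions
import HarnessLib

/-!
# Hoffman's composition relations (3), functional equation (4), Theorem 2.2, and Proposition 4.4
# (relations among the Springer numbers)

[cite: Hoffman1999DerivativePolynomials, §2 eq. (3), (4), Theorem 2.2; §4 Proposition 4.4 and the Remark following it (Electron. J. Combin. 6 (1999) #R21, pp. 3, 8–9)]

Continues `Literature.Combinatorics.Enumerative.DerivativePolynomialGeneratingFunctions` (the closed forms (1)
`P(u,t) = (sin t + u cos t)/(cos t − u sin t)`, `Q(u,t) = 1/(cos t − u sin t)` as `egfP u`, `egfQ u ∈ K⟦t⟧`, the values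
at `u = 0, 1`, Theorem 2.1, Theorem 3.1) with the *composition relations* and what Hoffman derives from them.

## Source (verbatim)

* «First, there are the composition relations (3) P(P(u,t),s) = P(u,t+s) and Q(P(u,t),s)Q(u,t) = Q(u,t+s);
  these follow from the representations P(u,t) = tan(tan⁻¹u + t) and Q(u,t) = sec(tan⁻¹u + t)/sec(tan⁻¹u),
  equivalent to equations (1) above.  Second, there is the functional equation
  (4) P(u,t) = P((u²−1)/2u, 2t) + (u²+1)/2u · Q((u²−1)/2u, 2t),
  which follows from equations (1) and the half-angle formula for tangent (cf. Theorem 3.1 of [12]).»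
* «Theorem 2.2. For nonnegative integers n,
  (i) Pₙ(P(u,s)) − tan s Σ_{k=0}^{n} binom(n,k) P_k(P(u,s)) P_{n−k}(u) = Pₙ(u) + δ_{0n} tan s;
  (ii) Qₙ(P(u,s)) − tan s Σ_{k=0}^{n} binom(n,k) Q_k(P(u,s)) P_{n−k}(u) = (1 − u tan s) Qₙ(u).
  Proof. The composition relation for P gives P(P(u,s),t) = P(u,s+t) = P(P(u,t),s) =
  (sin s + cos s P(u,t))/(cos s − sin s P(u,t)), or cos s P(P(u,s),t) − sin s P(P(u,s),t)P(u,t) = sin s + cos s P(u,t).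
  Take the coefficient of tⁿ/n! and divide by cos s to get (i). The proof of (ii) proceeds similarly, using the
  composition relation for Q.»
* «Proposition 4.4. For positive integers n,
  bₙ = ((−1)ⁿ + 1)/2 · a_{n−1} + Σ_{k odd} binom(n,k) a_{k−1} b_{n−k}  and  dₙ = (−1)^{n−1} a_{n−1} + Σ_{k odd} binom(n,k) a_{k−1} d_{n−k}.
  Proof. Set s = π/4 and u = 0 in Theorem 2.2: then the first identity follows from part (ii) of the theorem, and
  the second upon subtracting part (ii) from part (i).
  Remark. The formula for bₙ can be given a combinatorial interpretation. … we have
  bₙ = a_{n−1} + Σ_{2≤k≤n even} binom(n,k−1) a_{k−2} b_{n−k+1} = a_{n−1} + Σ_{k≤n−1 odd} binom(n,k) a_{k−1} b_{n−k},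
  which is equivalent to the first identity above.»
  (Here `aₙ = P_{n+1}(0) + Q_{n+1}(0) = E_{n+1}`, `bₙ = Qₙ(1)`, `dₙ = Pₙ(1) − Qₙ(1)`, Proposition 4.1.)

## What is typed, and how

The real parameter `s` enters only through `w = tan s` and `P(u,s) = tan(tan⁻¹u + s) = (u + w)/(1 − uw)`
(`tanAdd u w`); everything is stated over a field `K ⊇ ℚ` for `u, w ∈ K` with `uw ≠ 1`, as identities in `K⟦t⟧`
resp. of their coefficients — for real `s` with `cos s ≠ 0 ≠ cos s − u sin s` these are the printed statements.

* §1 (3) as addition theorems: `egfP_tanAdd_mul` — `P(v,t)(1 − w P(u,t)) = w + P(u,t)`, `v = P(u,s)` (Hoffman's displayed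
  form of (3) divided by `cos s`), and `egfQ_tanAdd_mul` — `Q(v,t)(1 − w P(u,t)) = (1 − uw) Q(u,t)`.  Proof: the closed
  forms (1) and one explicit polynomial identity (`linear_combination` against `D·D⁻¹ = 1`).
* §1b (4): `egfP_half_angle` — `P(u,t) = P(z,2t) + (u²+1)/2u · Q(z,2t)`, `z = (u²−1)/2u`, `u ≠ 0`, from the double-angle
  formulas `sin 2t = 2 sin t cos t`, `cos 2t = cos²t − sin²t` and `sin² + cos² = 1` (`egfP_mul_half_angle_den` is the
  cleared form).
* §2 Theorem 2.2 (i), (ii): `aeval_tanAdd_P`, `aeval_tanAdd_Q` — the coefficient of `tⁿ/n!` (`coeff_egf_mul`).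
* §3 Proposition 4.4 at `u = 0`, `w = tan(π/4) = 1`, `P(0,π/4) = 1`: the `ℕ`-identities `eval_one_P_eq_sum_eval_zero`,
  `eval_one_Q_eq_sum_eval_zero`; with `P_j(0) = [j odd]E_j`, `Q_n(0) = [n even]E_n` (the tree's `eval_zero_P/Q`) and
  `k ↦ n−k`: `springerB_relation` (first identity, `((−1)ⁿ+1)/2 = [n even]`; `springerB_relation_int` verbatim in `ℤ`),
  `springerD_relation` (second identity, `n ≥ 1`, in `ℤ`), `springerB_relation'` (the Remark's equivalent form),
  numerical check `springer_relations_small`.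

No new named facts (net debt 0).
-/

namespace Literature.Combinatorics.Enumerative
namespace DerivativePolynomials

open PowerSeries Finset
open scoped Nat
open Literature.ComputerArithmetic.BrentZimmermann2010

/-! ### §1 The composition relations (3) as addition theorems in `K⟦t⟧` -/

section Field

variable {K : Type*} [Field K]

/-- **`P(u,s)` as a function of `w = tan s`**: `tan(tan⁻¹u + s) = (u + tan s)/(1 − u tan s)`, the tangent
addition formula; Hoffman's real parameter `s` enters Theorem 2.2 only through `tan s` and `P(u,s)`.
[cite: Hoffman1999DerivativePolynomials, §2 («P(u,t) = tan(tan⁻¹ u + t)», eq. (3) and Theorem 2.2)] -/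
def tanAdd (u w : K) : K := (u + w) / (1 - u * w)

/-- `P(u,s)·(1 − u tan s) = u + tan s`. [cite: Hoffman1999DerivativePolynomials, §2 («P(u,t) = tan(tan⁻¹ u + t)»)] -/
theorem tanAdd_mul {u w : K} (h : u * w ≠ 1) : tanAdd u w * (1 - u * w) = u + w :=
  div_mul_cancel₀ _ (sub_ne_zero.2 (Ne.symm h))

/-- `P(0,s) = tan s`. [cite: Hoffman1999DerivativePolynomials, §2 («P₀(u) = u»; P(0,t) = tan t)] -/
@[simp] theorem tanAdd_zero_left (w : K) : tanAdd 0 w = w := by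
  simp [tanAdd]

/-- `P(u,0) = u`. [cite: Hoffman1999DerivativePolynomials, §2 («P₀(u) = u»)] -/
@[simp] theorem tanAdd_zero_right (u : K) : tanAdd u 0 = u := by
  simp [tanAdd]

/-- The addition law is symmetric. [cite: Hoffman1999DerivativePolynomials, §2 eq. (3) («P(P(u,t),s) = P(u,t+s)» is symmetric in s, t)] -/
theorem tanAdd_comm (u w : K) : tanAdd u w = tanAdd w u := by
  simp [tanAdd, add_comm, mul_comm]

/-- `P(0, π/4) = tan(π/4) = 1`: the specialisation used for Proposition 4.4.
[cite: Hoffman1999DerivativePolynomials, §4 proof of Proposition 4.4 («Set s = π/4 and u = 0 in Theorem 2.2»)] -/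
theorem tanAdd_zero_one : tanAdd (0 : K) 1 = 1 := by
  simp

variable [CharZero K]

/-- ★★ **The composition relation (3) for `P`** — `P(P(u,s),t) = P(u,s+t) = (sin s + cos s·P(u,t))/(cos s − sin s·P(u,t))`
— divided by `cos s` and written with `w = tan s`, `v = P(u,s) = (u+w)/(1−uw)`:
`P(v,t)·(1 − w·P(u,t)) = w + P(u,t)` in `K⟦t⟧` (the tangent addition theorem for the closed form (1)).
[cite: Hoffman1999DerivativePolynomials, §2 eq. (3) and proof of Theorem 2.2 («cos s P(P(u,s),t) − sin s P(P(u,s),t)P(u,t) = sin s + cos s P(u,t)»)] -/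
theorem egfP_tanAdd_mul {u w : K} (h : u * w ≠ 1) :
    egfP (tanAdd u w) * (1 - C w * egfP u) = C w + egfP u := by
  have hD := den_mul_inv u
  have hDv := den_mul_inv (tanAdd u w)
  have hv : (C (tanAdd u w * (1 - u * w)) : K⟦X⟧) = C (u + w) := by rw [tanAdd_mul h]
  rw [map_mul, map_sub, map_one, map_mul, map_add] at hv
  rw [egfP_eq, egfP_eq]
  set s := PowerSeries.sin K
  set c := PowerSeries.cos K
  set X := (c - C u * s)⁻¹
  set Y := (c - C (tanAdd u w) * s)⁻¹
  linear_combination (C w - (s + C (tanAdd u w) * c) * Y) * hD +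
    (1 - C u * C w) * (s + C (tanAdd u w) * c) * X * hDv + (s * (s + C (tanAdd u w) * c) * Y * X + c * X) * hv

/-- ★★ **The composition relation (3) for `Q`** — `Q(P(u,s),t)·Q(u,s) = Q(u,s+t)` — in the same form:
`Q(v,t)·(1 − w·P(u,t)) = (1 − uw)·Q(u,t)` (`w = tan s`, `v = P(u,s)`).
[cite: Hoffman1999DerivativePolynomials, §2 eq. (3) («Q(P(u,t),s)Q(u,t) = Q(u,t+s)») and proof of Theorem 2.2(ii)] -/
theorem egfQ_tanAdd_mul {u w : K} (h : u * w ≠ 1) :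
    egfQ (tanAdd u w) * (1 - C w * egfP u) = C (1 - u * w) * egfQ u := by
  have hD := den_mul_inv u
  have hDv := den_mul_inv (tanAdd u w)
  have hv : (C (tanAdd u w * (1 - u * w)) : K⟦X⟧) = C (u + w) := by rw [tanAdd_mul h]
  rw [map_mul, map_sub, map_one, map_mul, map_add] at hv
  rw [egfQ_eq, egfQ_eq, egfP_eq, map_sub, map_one, map_mul]
  set s := PowerSeries.sin K
  set c := PowerSeries.cos K
  set X := (c - C u * s)⁻¹
  set Y := (c - C (tanAdd u w) * s)⁻¹
  linear_combination (-Y) * hD + (1 - C u * C w) * X * hDv + s * Y * X * hv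

/-! ### §1b The functional equation (4) (half-angle substitution) -/

omit [CharZero K] in
/-- `rescale` fixes constants. [folklore] -/
private theorem rescale_C' (a r : K) : rescale a (C r) = (C r : K⟦X⟧) := by
  ext n
  rw [coeff_rescale, coeff_C]
  split_ifs with h
  · subst h; simp
  · simp

omit [CharZero K] in
/-- `rescale` does not change the constant term. [folklore] -/
private theorem constantCoeff_rescale' (a : K) (f : K⟦X⟧) : constantCoeff (rescale a f) = constantCoeff f := by
  rw [← coeff_zero_eq_constantCoeff_apply, coeff_rescale, pow_zero, one_mul, coeff_zero_eq_constantCoeff_apply]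

/-- The functional equation (4) with the denominator `cos 2t − z sin 2t` of `P(z,2t)`, `Q(z,2t)` cleared
(`z = (u²−1)/2u`): `P(u,t)·(cos 2t − z sin 2t) = sin 2t + z cos 2t + (u²+1)/2u` — the half-angle formulas.
[cite: Hoffman1999DerivativePolynomials, §2 eq. (4) («which follows from equations (1) and the half-angle formula for tangent»)] -/
theorem egfP_mul_half_angle_den {u : K} (hu : u ≠ 0) :
    egfP u * (rescale 2 (PowerSeries.cos K) - C ((u ^ 2 - 1) / (2 * u)) * rescale 2 (PowerSeries.sin K)) =
      rescale 2 (PowerSeries.sin K) + C ((u ^ 2 - 1) / (2 * u)) * rescale 2 (PowerSeries.cos K) +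
        C ((u ^ 2 + 1) / (2 * u)) := by
  have h2u : (2 * u : K) ≠ 0 := mul_ne_zero two_ne_zero hu
  set z : K := (u ^ 2 - 1) / (2 * u) with hzdef
  set m : K := (u ^ 2 + 1) / (2 * u) with hmdef
  have hz : 2 * u * z = u ^ 2 - 1 := by rw [hzdef, mul_div_cancel₀ _ h2u]
  have hm : 2 * u * m = u ^ 2 + 1 := by rw [hmdef, mul_div_cancel₀ _ h2u]
  have hi : (2 * u)⁻¹ * (2 * u) = (1 : K) := inv_mul_cancel₀ h2u
  have hz' : (2 : K⟦X⟧) * C u * C z = C u ^ 2 - 1 := by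
    have := congrArg (fun x : K => (C x : K⟦X⟧)) hz
    simpa only [map_mul, map_sub, map_pow, map_one, map_ofNat] using this
  have hm' : (2 : K⟦X⟧) * C u * C m = C u ^ 2 + 1 := by
    have := congrArg (fun x : K => (C x : K⟦X⟧)) hm
    simpa only [map_mul, map_add, map_pow, map_one, map_ofNat] using this
  have hi' : (C (2 * u)⁻¹ : K⟦X⟧) * (2 * C u) = 1 := by
    have := congrArg (fun x : K => (C x : K⟦X⟧)) hi
    simpa only [map_mul, map_one, map_ofNat] using this
  have hD := den_mul_inv u
  have hsc := sin_sq_add_cos_sq_eq (K := K)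
  rw [rescale_two_cos, rescale_two_sin, egfP_eq]
  set s := PowerSeries.sin K
  set c := PowerSeries.cos K
  set X := (c - C u * s)⁻¹
  set ι : K⟦X⟧ := C (2 * u)⁻¹
  linear_combination (-((s + C u * c) * X * (c ^ 2 - s ^ 2 - C z * (2 * s * c)) -
      (2 * s * c + C z * (c ^ 2 - s ^ 2) + C m))) * hi' + ι * (2 * (s + C u * c) ^ 2) * hD +
    ι * (C u ^ 2 + 1) * hsc - ι * ((s + C u * c) * X * 2 * s * c + (c ^ 2 - s ^ 2)) * hz' - ι * hm'

/-- ★★ **The functional equation (4)**: for `u ≠ 0`,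
`P(u,t) = P((u²−1)/2u, 2t) + (u²+1)/2u · Q((u²−1)/2u, 2t)` («which follows from equations (1) and the half-angle
formula for tangent (cf. Theorem 3.1 of [12])»; at `u = 1` it is `P(1,t) = tan 2t + sec 2t`, eq. (5)).
[cite: Hoffman1999DerivativePolynomials, §2 eq. (4) («P(u,t) = P((u²−1)/2u, 2t) + (u²+1)/2u · Q((u²−1)/2u, 2t)»)] -/
theorem egfP_half_angle {u : K} (hu : u ≠ 0) :
    egfP u = rescale 2 (egfP ((u ^ 2 - 1) / (2 * u))) +
      C ((u ^ 2 + 1) / (2 * u)) * rescale 2 (egfQ ((u ^ 2 - 1) / (2 * u))) := by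
  set z : K := (u ^ 2 - 1) / (2 * u) with hzdef
  have hconst : constantCoeff (rescale 2 (PowerSeries.cos K) - C z * rescale 2 (PowerSeries.sin K)) = 1 := by
    rw [map_sub, map_mul, constantCoeff_rescale', constantCoeff_rescale', constantCoeff_cos_eq, constantCoeff_sin_eq,
      mul_zero, sub_zero]
  have hne : rescale 2 (PowerSeries.cos K) - C z * rescale 2 (PowerSeries.sin K) ≠ 0 := fun h0 => by
    have := congrArg constantCoeff h0
    rw [hconst, map_zero] at this
    exact one_ne_zero this
  apply mul_right_cancel₀ hne
  have hP := congrArg (rescale (2 : K)) (egfP_mul_den z)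
  have hQ := congrArg (rescale (2 : K)) (egfQ_mul_den z)
  simp only [map_mul, map_sub, map_add, map_one, rescale_C'] at hP hQ
  rw [egfP_mul_half_angle_den hu, add_mul, mul_assoc, hP, hQ, mul_one]

/-! ### §2 Theorem 2.2: the coefficient of `tⁿ/n!` -/

omit [CharZero K] in
/-- `n!·[n = 0]·w = [n = 0]·w`. [folklore] -/
private theorem ite_div_factorial (w : K) (n : ℕ) :
    (if n = 0 then w else 0 : K) = (if n = 0 then w else 0) / (n ! : K) := by
  split_ifs with h0
  · subst h0; simp
  · simp

/-- ★★★ **Theorem 2.2 (i)**: for `n ≥ 0`,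
`Pₙ(P(u,s)) − tan s · Σ_{k=0}^{n} binom(n,k) P_k(P(u,s)) P_{n−k}(u) = Pₙ(u) + δ_{0n} tan s`
(with `tan s = w`, `P(u,s) = (u+w)/(1−uw)`, `u tan s ≠ 1`).
[cite: Hoffman1999DerivativePolynomials, §2 Theorem 2.2(i) («P_n(P(u,s)) − tan s Σ_{k=0}^{n} binom(n,k) P_k(P(u,s)) P_{n−k}(u) = P_n(u) + δ_{0n} tan s»)] -/
theorem aeval_tanAdd_P {u w : K} (h : u * w ≠ 1) (n : ℕ) :
    Polynomial.aeval (tanAdd u w) (TangentNumbers.P n) -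
        w * ∑ k ∈ range (n + 1), (n.choose k : K) * Polynomial.aeval (tanAdd u w) (TangentNumbers.P k) *
          Polynomial.aeval u (TangentNumbers.P (n - k)) =
      Polynomial.aeval u (TangentNumbers.P n) + if n = 0 then w else 0 := by
  have h1 := PowerSeries.ext_iff.1 (egfP_tanAdd_mul h) n
  have hmul : coeff n (egfP (tanAdd u w) * egfP u) = (∑ k ∈ range (n + 1), (n.choose k : K) *
      Polynomial.aeval (tanAdd u w) (TangentNumbers.P k) * Polynomial.aeval u (TangentNumbers.P (n - k))) /
        (n ! : K) :=
    coeff_egf_mul _ _ n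
  rw [mul_sub, mul_one, mul_left_comm, map_sub, coeff_C_mul, hmul, coeff_egfP, map_add, coeff_C,
    coeff_egfP, ite_div_factorial w n, mul_div_assoc', ← sub_div, ← add_div,
    div_left_inj' (Nat.cast_ne_zero.2 (Nat.factorial_ne_zero n))] at h1
  rw [h1, add_comm]

/-- ★★★ **Theorem 2.2 (ii)**: for `n ≥ 0`,
`Qₙ(P(u,s)) − tan s · Σ_{k=0}^{n} binom(n,k) Q_k(P(u,s)) P_{n−k}(u) = (1 − u tan s) Qₙ(u)`.
[cite: Hoffman1999DerivativePolynomials, §2 Theorem 2.2(ii) («Q_n(P(u,s)) − tan s Σ_{k=0}^{n} binom(n,k) Q_k(P(u,s)) P_{n−k}(u) = (1 − u tan s) Q_n(u)»)] -/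
theorem aeval_tanAdd_Q {u w : K} (h : u * w ≠ 1) (n : ℕ) :
    Polynomial.aeval (tanAdd u w) (TangentNumbers.Q n) -
        w * ∑ k ∈ range (n + 1), (n.choose k : K) * Polynomial.aeval (tanAdd u w) (TangentNumbers.Q k) *
          Polynomial.aeval u (TangentNumbers.P (n - k)) =
      (1 - u * w) * Polynomial.aeval u (TangentNumbers.Q n) := by
  have h1 := PowerSeries.ext_iff.1 (egfQ_tanAdd_mul h) n
  have hmul : coeff n (egfQ (tanAdd u w) * egfP u) = (∑ k ∈ range (n + 1), (n.choose k : K) *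
      Polynomial.aeval (tanAdd u w) (TangentNumbers.Q k) * Polynomial.aeval u (TangentNumbers.P (n - k))) /
        (n ! : K) :=
    coeff_egf_mul _ _ n
  rw [mul_sub, mul_one, mul_left_comm, map_sub, coeff_C_mul, hmul, coeff_egfQ, coeff_C_mul, coeff_egfQ,
    mul_div_assoc', mul_div_assoc', ← sub_div, div_left_inj' (Nat.cast_ne_zero.2 (Nat.factorial_ne_zero n))] at h1
  exact h1

end Field

/-! ### §3 `s = π/4`, `u = 0`: Proposition 4.4 — relations among the Springer numbers -/

section SpringerRelations

/-- Theorem 2.2(i) at `u = 0`, `s = π/4` (`tan s = 1`, `P(0,π/4) = 1`), in `ℕ`: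
`Pₙ(1) = Pₙ(0) + δ_{0n} + Σ_k binom(n,k) P_k(1) P_{n−k}(0)`.
[cite: Hoffman1999DerivativePolynomials, §4 proof of Proposition 4.4 («Set s = π/4 and u = 0 in Theorem 2.2»)] -/
theorem eval_one_P_eq_sum_eval_zero (n : ℕ) :
    (TangentNumbers.P n).eval 1 = (TangentNumbers.P n).eval 0 + (if n = 0 then 1 else 0) +
      ∑ k ∈ range (n + 1), n.choose k * (TangentNumbers.P k).eval 1 * (TangentNumbers.P (n - k)).eval 0 := by
  have h := aeval_tanAdd_P (K := ℚ) (u := 0) (w := 1) (by norm_num) n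
  simp only [tanAdd_zero_one, aeval_one_nat, aeval_zero_nat, Polynomial.coeff_zero_eq_eval_zero, one_mul] at h
  have h' : ((if n = 0 then (1 : ℚ) else 0)) = ((if n = 0 then 1 else 0 : ℕ) : ℚ) := by
    split_ifs <;> simp
  rw [h', sub_eq_iff_eq_add] at h
  have key : (((TangentNumbers.P n).eval 1 : ℕ) : ℚ) = (((TangentNumbers.P n).eval 0 + (if n = 0 then 1 else 0) +
      ∑ k ∈ range (n + 1), n.choose k * (TangentNumbers.P k).eval 1 * (TangentNumbers.P (n - k)).eval 0 : ℕ) : ℚ) := by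
    rw [h]; push_cast; ring
  exact_mod_cast key

/-- Theorem 2.2(ii) at `u = 0`, `s = π/4`, in `ℕ`: `Qₙ(1) = Qₙ(0) + Σ_k binom(n,k) Q_k(1) P_{n−k}(0)`.
[cite: Hoffman1999DerivativePolynomials, §4 proof of Proposition 4.4 («the first identity follows from part (ii) of the theorem»)] -/
theorem eval_one_Q_eq_sum_eval_zero (n : ℕ) :
    (TangentNumbers.Q n).eval 1 = (TangentNumbers.Q n).eval 0 +
      ∑ k ∈ range (n + 1), n.choose k * (TangentNumbers.Q k).eval 1 * (TangentNumbers.P (n - k)).eval 0 := by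
  have h := aeval_tanAdd_Q (K := ℚ) (u := 0) (w := 1) (by norm_num) n
  simp only [tanAdd_zero_one, aeval_one_nat, aeval_zero_nat, Polynomial.coeff_zero_eq_eval_zero, one_mul,
    zero_mul, sub_zero] at h
  rw [sub_eq_iff_eq_add] at h
  have key : (((TangentNumbers.Q n).eval 1 : ℕ) : ℚ) = (((TangentNumbers.Q n).eval 0 +
      ∑ k ∈ range (n + 1), n.choose k * (TangentNumbers.Q k).eval 1 * (TangentNumbers.P (n - k)).eval 0 : ℕ) : ℚ) := by
    rw [h]; push_cast; ring
  exact_mod_cast key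

/-- Re-indexing `k ↦ n − k` and `P_j(0) = [j odd]E_j`: `Σ_k binom(n,k) x_k P_{n−k}(0) = Σ_{j odd} binom(n,j) E_j x_{n−j}`.
[cite: Hoffman1999DerivativePolynomials, §4 Proposition 4.4 (the sums «Σ_{k odd} binom(n,k) a_{k−1} b_{n−k}»)] -/
theorem sum_choose_mul_eval_zero_P (x : ℕ → ℕ) (n : ℕ) :
    ∑ k ∈ range (n + 1), n.choose k * x k * (TangentNumbers.P (n - k)).eval 0 =
      ∑ j ∈ (range (n + 1)).filter Odd, n.choose j * eulerZigzag j * x (n - j) := by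
  rw [← sum_range_reflect, sum_filter]
  refine sum_congr rfl fun j hj => ?_
  have hjn : j ≤ n := Nat.lt_succ_iff.1 (mem_range.1 hj)
  rw [show n + 1 - 1 - j = n - j by omega, Nat.sub_sub_self hjn, Nat.choose_symm hjn, eval_zero_P]
  split_ifs with h1 h2 h2
  · exact absurd h1 (Nat.not_even_iff_odd.2 h2)
  · rw [mul_zero]
  · ring
  · exact absurd (Nat.not_even_iff_odd.1 h1) h2

/-- ★★★ **Proposition 4.4, first identity**: for the Springer numbers `bₙ = Qₙ(1)` and `a_{k−1} = E_k`,
`bₙ = ((−1)ⁿ + 1)/2 · a_{n−1} + Σ_{k odd} binom(n,k) a_{k−1} b_{n−k}` — here in `ℕ` with `((−1)ⁿ+1)/2 = [n even]`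
(valid for all `n ≥ 0`; printed for `n ≥ 1`).
[cite: Hoffman1999DerivativePolynomials, §4 Proposition 4.4 («b_n = ((−1)^n + 1)/2 · a_{n−1} + Σ_{k odd} binom(n,k) a_{k−1} b_{n−k}»)] -/
theorem springerB_relation (n : ℕ) :
    (TangentNumbers.Q n).eval 1 = (if Even n then eulerZigzag n else 0) +
      ∑ k ∈ (range (n + 1)).filter Odd, n.choose k * eulerZigzag k * (TangentNumbers.Q (n - k)).eval 1 := by
  rw [eval_one_Q_eq_sum_eval_zero, eval_zero_Q, sum_choose_mul_eval_zero_P]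

/-- The printed coefficient: `((−1)ⁿ + 1)/2 = [n even]`. [cite: Hoffman1999DerivativePolynomials, §4 Proposition 4.4 («((−1)^n + 1)/2»)] -/
theorem neg_one_pow_add_one_div_two (n : ℕ) : (((-1 : ℤ) ^ n + 1) / 2) = if Even n then 1 else 0 := by
  rcases Nat.even_or_odd n with h | h
  · rw [h.neg_one_pow, if_pos h]; norm_num
  · rw [h.neg_one_pow, if_neg (Nat.not_even_iff_odd.2 h)]; norm_num

/-- Proposition 4.4 (i) exactly as printed, in `ℤ`: `bₙ = ((−1)ⁿ+1)/2 · a_{n−1} + Σ_{k odd} binom(n,k) a_{k−1} b_{n−k}`.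
[cite: Hoffman1999DerivativePolynomials, §4 Proposition 4.4 (first identity)] -/
theorem springerB_relation_int (n : ℕ) :
    (((TangentNumbers.Q n).eval 1 : ℕ) : ℤ) = ((-1 : ℤ) ^ n + 1) / 2 * eulerZigzag n +
      ∑ k ∈ (range (n + 1)).filter Odd, (n.choose k : ℤ) * eulerZigzag k * (((TangentNumbers.Q (n - k)).eval 1 : ℕ) : ℤ) := by
  rw [springerB_relation, neg_one_pow_add_one_div_two]
  push_cast
  split_ifs <;> simp

/-- ★★★ **Proposition 4.4, second identity**: for `n ≥ 1` and `dₙ = Pₙ(1) − Qₙ(1)`,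
`dₙ = (−1)^{n−1} a_{n−1} + Σ_{k odd} binom(n,k) a_{k−1} d_{n−k}` (in `ℤ`; «the second upon subtracting part (ii)
from part (i)»). [cite: Hoffman1999DerivativePolynomials, §4 Proposition 4.4 («d_n = (−1)^{n−1} a_{n−1} + Σ_{k odd} binom(n,k) a_{k−1} d_{n−k}»)] -/
theorem springerD_relation {n : ℕ} (hn : 1 ≤ n) :
    (((TangentNumbers.P n).eval 1 : ℕ) : ℤ) - (((TangentNumbers.Q n).eval 1 : ℕ) : ℤ) =
      (-1 : ℤ) ^ (n - 1) * eulerZigzag n +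
        ∑ k ∈ (range (n + 1)).filter Odd, (n.choose k : ℤ) * eulerZigzag k *
          ((((TangentNumbers.P (n - k)).eval 1 : ℕ) : ℤ) - (((TangentNumbers.Q (n - k)).eval 1 : ℕ) : ℤ)) := by
  have hP := eval_one_P_eq_sum_eval_zero n
  have hQ := eval_one_Q_eq_sum_eval_zero n
  rw [sum_choose_mul_eval_zero_P] at hP hQ
  rw [if_neg (by omega : n ≠ 0), add_zero] at hP
  have hPQ0 : (((TangentNumbers.P n).eval 0 : ℕ) : ℤ) - (((TangentNumbers.Q n).eval 0 : ℕ) : ℤ) =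
      (-1 : ℤ) ^ (n - 1) * eulerZigzag n := by
    rw [eval_zero_P, eval_zero_Q]
    rcases Nat.even_or_odd n with h | h
    · have h1 : Odd (n - 1) := by
        obtain ⟨m, rfl⟩ := h; exact ⟨m - 1, by omega⟩
      rw [if_pos h, if_pos h, h1.neg_one_pow]; push_cast; ring
    · have h1 : Even (n - 1) := by
        obtain ⟨m, rfl⟩ := h; exact ⟨m, by omega⟩
      rw [if_neg (Nat.not_even_iff_odd.2 h), if_neg (Nat.not_even_iff_odd.2 h), h1.neg_one_pow]; push_cast; ring
  rw [hP, hQ]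
  push_cast
  rw [← hPQ0]
  simp only [mul_sub, sum_sub_distrib]
  ring

/-- The Remark's equivalent form of the first identity: `bₙ = a_{n−1} + Σ_{k ≤ n−1, k odd} binom(n,k) a_{k−1} b_{n−k}`
(for odd `n` the term `k = n` of Proposition 4.4 is `a_{n−1}`; with `a_{n−1} = E_n` it also holds at `n = 0`). «The formula for bₙ can be given a combinatorial
interpretation» (all-positive snakes ↔ `Ā_{n−1}`, otherwise split at the first negative entry).
[cite: Hoffman1999DerivativePolynomials, §4 Remark after Proposition 4.4 («b_n = a_{n−1} + Σ_{k≤n−1 odd} binom(n,k) a_{k−1} b_{n−k}, which is equivalent to the first identity above»)] -/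
theorem springerB_relation' (n : ℕ) :
    (TangentNumbers.Q n).eval 1 = eulerZigzag n +
      ∑ k ∈ (range n).filter Odd, n.choose k * eulerZigzag k * (TangentNumbers.Q (n - k)).eval 1 := by
  rw [springerB_relation, range_add_one, filter_insert]
  rcases Nat.even_or_odd n with h | h
  · rw [if_pos h, if_neg (Nat.not_odd_iff_even.2 h)]
  · rw [if_neg (Nat.not_even_iff_odd.2 h), if_pos h, sum_insert (by simp), zero_add, Nat.choose_self, Nat.sub_self,
      TangentNumbers.Q, Polynomial.eval_one, one_mul, mul_one]

/-- Proposition 4.4 at `n = 4` and `n = 5` with the tree's values `b = 1, 1, 3, 11, 57, 361`, `E = 1, 1, 1, 2, 5, 16`: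
`57 = 5 + 4·1·11 + 4·2·1` and `361 = 0 + 5·1·57 + 10·2·3 + 1·16·1`; and `d₄ = P₄(1) − Q₄(1) = 80 − 57 = 23 =
−5 + 4·1·(16−11) + 4·2·(2−1)`. [cite: Hoffman1999DerivativePolynomials, §4 Proposition 4.4; Arnold1992Snakes (tables of a_n, b_n, d_n)] -/
theorem springer_relations_small :
    (57 : ℕ) = 5 + 4 * 1 * 11 + 4 * 2 * 1 ∧ (361 : ℕ) = 0 + 5 * 1 * 57 + 10 * 2 * 3 + 1 * 16 * 1 ∧
      (80 - 57 : ℤ) = -5 + 4 * 1 * (16 - 11) + 4 * 2 * (2 - 1) ∧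
        (TangentNumbers.Q 4).eval 1 = 57 ∧ (TangentNumbers.Q 5).eval 1 = 361 ∧ (TangentNumbers.P 4).eval 1 = 80 := by
  have hq := eval_one_Q_values
  have hp := eval_one_P_values
  simp only [List.cons.injEq, and_true] at hq hp
  refine ⟨by norm_num, by norm_num, by norm_num, hq.2.2.2.2.1, hq.2.2.2.2.2.1, hp.2.2.2.2.1⟩

end SpringerRelations

end DerivativePolynomials
end Literature.Combinatorics.Enumerative
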